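import Summits.CriticalPhenomena.PercolationContinuityZ3.Theorems.PercNearOneGluingNoHeavyLowerTailSahiTwoChainUnions
import Summits.CriticalPhenomena.PercolationContinuityZ3.Theorems.PercNearOneGluingNoHeavyLowerTailIncStarCycleEmbedded
import HarnessLib

/-!
# Sahi positivity of every order for CAPS of two independent chains (principal cluster events of a cycle)

Support file for the Sahi programme (`--supports stmt-CriticalPhenomena-4575`, prover prim-sahi-p2 gen 9).
No definitions, no named facts, no sorries; standard axioms.  Memo `…/prim-sahi-p2/PROOF-E3.md` §20.
Companion of `…SahiTwoChainUnions.lean` (gen 8: the UNIONS `R k ∪ L k` of a shrinking and a growing chain).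

**Setting.**  A finite type `α` with a probability weight `μ`; an antitone chain of events `R v` and a monotone
chain `L v`, `v : Fin m` ("the clockwise arc from the root reaches `v`", "the counter-clockwise arc reaches
`v`"), such that `R v` and `L v'` are uncorrelated for `v ≤ v'` (on a cycle: disjoint edge sets).  The CAP of a
finite target set `U ⊆ Fin m` is the event `⋂_{t ∈ U} (R t ∪ L t)` ("every target is reached by one of the two
arcs" = the principal cluster event `{C_root ⊇ U}` of the cycle).

**Theorem `sahiE_nonneg_of_twoChainCaps`.**  For every `n` and all target sets `T_0,…,T_{n-1}`,
`0 ≤ E_n(1_{cap T_0}, …, 1_{cap T_{n-1}})`.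

**Proof.**  Caps are closed under intersection, so every product moment of a cap family is the probability of a
single cap.  STAIRCASE RECURSION (`ind_cap_insert_min`): if `u < U` and `v ≤ u` then, pointwise,
`1_{R v}·1_{cap (u ∪ U)} = 1_{R u}·1_{cap U} + 1_{R v}·1_{L u} − 1_{R u}·1_{L u}` (because `R u ⊆ R v` and
`L u ⊆ cap U`); taking expectations, only pairs `E[1_{R v} 1_{L v'}]` with `v ≤ v'` ever occur, so the cap
probabilities are the SAME polynomial in the one-chain probabilities `P(R v)`, `P(L v)` for any two systems of
chains with the stated independence (`ex_ind_cap_congr`).  Model system: the PRODUCT of the laws of the two chain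
levels on `Fin (m+1) × Fin (m+1)` with the coordinate chains, where caps are increasing events and Sahi
positivity of every order is Lieb–Sahi's theorem for product weights on a product of two chains (tree
`ProductChains.sahiPositive_prodWeight_linearOrder`); transfer by `TwoChainUnions.sahiE_congr_of_prodMoments`.
(The joint law of the two levels is not a product law; only the pairs `v ≤ v'` are needed.)
-/

noncomputable section

namespace Summit.CriticalPhenomena.PercolationContinuityZ3.Theorems

namespace TwoChainCaps

open Finset Literature.Combinatorics.Sahi2008
open Literature.Probability.Percolation.DecisionTree (ind ind_of_mem ind_of_not_mem ind_nonneg)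
open scoped Classical

variable {α β : Type*} [Fintype α] [Fintype β] {m : ℕ}

/-! ### Indicator plumbing -/

omit [Fintype α] in
/-- Membership in a cap. [folklore] -/
private theorem mem_cap_iff (R L : Fin m → Set α) (U : Finset (Fin m)) (x : α) :
    x ∈ (⋂ t ∈ U, (R t ∪ L t)) ↔ ∀ t ∈ U, x ∈ R t ∨ x ∈ L t := by
  simp only [Set.mem_iInter, Set.mem_union]

omit [Fintype α] in
/-- Indicator of the monotone image of an up-set is monotone (plumbing). [folklore] -/
private theorem monotone_ind_of_upper {γ : Type*} [Preorder γ] {A : Set γ} (hA : IsUpperSet A) :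
    Monotone (ind A) := by
  intro p q hpq
  by_cases hp : p ∈ A
  · rw [ind_of_mem hp, ind_of_mem (hA hpq hp)]
  · rw [ind_of_not_mem hp]; exact ind_nonneg A q

omit [Fintype α] in
/-- Products of cap indicators are cap indicators of the union of the target sets. [folklore] -/
theorem prod_ind_cap (R L : Fin m → Set α) {n : ℕ} (T : Fin n → Finset (Fin m)) (S : Finset (Fin n)) :
    ∏ i ∈ S, ind (⋂ t ∈ T i, (R t ∪ L t)) = ind (⋂ t ∈ S.biUnion T, (R t ∪ L t)) := by
  rw [IncStarCycle.prod_ind_eq_ind_iInter, Finset.set_biInter_biUnion]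

omit [Fintype α] in
/-- **Staircase recursion (with a floor).**  For an antitone chain `R`, a monotone chain `L`, a target set `U`
with a new minimal target `u`, and `v ≤ u`:
`1_{R v}·1_{cap (u ∪ U)} = 1_{R u}·1_{cap U} + 1_{R v}·1_{L u} − 1_{R u}·1_{L u}`. [this work] -/
theorem ind_cap_insert_min (R L : Fin m → Set α)
    (hR : ∀ ⦃v v' : Fin m⦄, v ≤ v' → R v' ⊆ R v) (hL : ∀ ⦃v v' : Fin m⦄, v ≤ v' → L v ⊆ L v')
    {u : Fin m} {U : Finset (Fin m)} (hu : ∀ t ∈ U, u ≤ t) {v : Fin m} (hv : v ≤ u) :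
    ind (R v) * ind (⋂ t ∈ insert u U, (R t ∪ L t)) =
      ind (R u) * ind (⋂ t ∈ U, (R t ∪ L t)) + ind (R v) * ind (L u) - ind (R u) * ind (L u) := by
  funext x
  simp only [Pi.mul_apply, Pi.add_apply, Pi.sub_apply]
  have hcapI : x ∈ (⋂ t ∈ insert u U, (R t ∪ L t)) ↔ (x ∈ R u ∨ x ∈ L u) ∧ x ∈ (⋂ t ∈ U, (R t ∪ L t)) := by
    rw [mem_cap_iff, mem_cap_iff, Finset.forall_mem_insert]
  by_cases hLu : x ∈ L u
  · have hC : x ∈ (⋂ t ∈ U, (R t ∪ L t)) := (mem_cap_iff R L U x).2 fun t ht => Or.inr (hL (hu t ht) hLu)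
    have hCI : x ∈ (⋂ t ∈ insert u U, (R t ∪ L t)) := hcapI.2 ⟨Or.inr hLu, hC⟩
    rw [ind_of_mem hLu, ind_of_mem hC, ind_of_mem hCI]
    ring
  · rw [ind_of_not_mem hLu]
    by_cases hRu : x ∈ R u
    · have hRv : x ∈ R v := hR hv hRu
      rw [ind_of_mem hRu, ind_of_mem hRv]
      by_cases hC : x ∈ (⋂ t ∈ U, (R t ∪ L t))
      · rw [ind_of_mem hC, ind_of_mem (hcapI.2 ⟨Or.inl hRu, hC⟩)]; ring
      · rw [ind_of_not_mem hC, ind_of_not_mem (fun h => hC (hcapI.1 h).2)]; ring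
    · rw [ind_of_not_mem hRu, ind_of_not_mem (fun h => ((hcapI.1 h).1.elim hRu hLu))]
      ring

omit [Fintype α] in
/-- **Staircase recursion (no floor):** `1_{cap (u ∪ U)} = 1_{R u}·1_{cap U} + 1_{L u} − 1_{R u}·1_{L u}` for a
new minimal target `u`. [this work] -/
theorem ind_cap_insert_min' (R L : Fin m → Set α)
    (hL : ∀ ⦃v v' : Fin m⦄, v ≤ v' → L v ⊆ L v')
    {u : Fin m} {U : Finset (Fin m)} (hu : ∀ t ∈ U, u ≤ t) :
    ind (⋂ t ∈ insert u U, (R t ∪ L t)) =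
      ind (R u) * ind (⋂ t ∈ U, (R t ∪ L t)) + ind (L u) - ind (R u) * ind (L u) := by
  funext x
  simp only [Pi.mul_apply, Pi.add_apply, Pi.sub_apply]
  have hcapI : x ∈ (⋂ t ∈ insert u U, (R t ∪ L t)) ↔ (x ∈ R u ∨ x ∈ L u) ∧ x ∈ (⋂ t ∈ U, (R t ∪ L t)) := by
    rw [mem_cap_iff, mem_cap_iff, Finset.forall_mem_insert]
  by_cases hLu : x ∈ L u
  · have hC : x ∈ (⋂ t ∈ U, (R t ∪ L t)) := (mem_cap_iff R L U x).2 fun t ht => Or.inr (hL (hu t ht) hLu)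
    rw [ind_of_mem hLu, ind_of_mem hC, ind_of_mem (hcapI.2 ⟨Or.inr hLu, hC⟩)]
    ring
  · rw [ind_of_not_mem hLu]
    by_cases hRu : x ∈ R u
    · rw [ind_of_mem hRu]
      by_cases hC : x ∈ (⋂ t ∈ U, (R t ∪ L t))
      · rw [ind_of_mem hC, ind_of_mem (hcapI.2 ⟨Or.inl hRu, hC⟩)]; ring
      · rw [ind_of_not_mem hC, ind_of_not_mem (fun h => hC (hcapI.1 h).2)]; ring
    · rw [ind_of_not_mem hRu, ind_of_not_mem (fun h => ((hcapI.1 h).1.elim hRu hLu))]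
      ring

/-! ### Cap probabilities are determined by the one-chain probabilities -/

omit [Fintype β] in
/-- `E(f + g - h) = E f + E g - E h` (plumbing). [folklore] -/
private theorem ex_add_sub (μ : α → ℝ) (f g h : α → ℝ) : ex μ (f + g - h) = ex μ f + ex μ g - ex μ h := by
  simp only [ex_def, Pi.add_apply, Pi.sub_apply, mul_add, mul_sub, sum_add_distrib, sum_sub_distrib]

/-- **Cap probabilities agree for two chain systems with the same one-chain probabilities.**  Two systems of
chains (`R, L` on `α` under `μ`; `R', L'` on `β` under `ν`), each antitone/monotone with `R v ⊥ L v'` for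
`v ≤ v'`, and with `P(R v) = P(R' v)`, `P(L v) = P(L' v)` for all `v`, give the same probability to every cap
(and to every `R v ∩ cap U` with `v ≤ min U`). [this work] -/
theorem ex_ind_cap_congr (μ : α → ℝ) (ν : β → ℝ) (hμ : ∑ x, μ x = 1) (hν : ∑ y, ν y = 1)
    (R L : Fin m → Set α) (R' L' : Fin m → Set β)
    (hR : ∀ ⦃v v' : Fin m⦄, v ≤ v' → R v' ⊆ R v) (hL : ∀ ⦃v v' : Fin m⦄, v ≤ v' → L v ⊆ L v')
    (hR' : ∀ ⦃v v' : Fin m⦄, v ≤ v' → R' v' ⊆ R' v) (hL' : ∀ ⦃v v' : Fin m⦄, v ≤ v' → L' v ⊆ L' v')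
    (hind : ∀ v v' : Fin m, v ≤ v' → ex μ (ind (R v) * ind (L v')) = ex μ (ind (R v)) * ex μ (ind (L v')))
    (hind' : ∀ v v' : Fin m, v ≤ v' → ex ν (ind (R' v) * ind (L' v')) = ex ν (ind (R' v)) * ex ν (ind (L' v')))
    (ha : ∀ v, ex μ (ind (R v)) = ex ν (ind (R' v))) (hb : ∀ v, ex μ (ind (L v)) = ex ν (ind (L' v)))
    (U : Finset (Fin m)) :
    ex μ (ind (⋂ t ∈ U, (R t ∪ L t))) = ex ν (ind (⋂ t ∈ U, (R' t ∪ L' t))) ∧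
      ∀ v : Fin m, (∀ t ∈ U, v ≤ t) →
        ex μ (ind (R v) * ind (⋂ t ∈ U, (R t ∪ L t))) = ex ν (ind (R' v) * ind (⋂ t ∈ U, (R' t ∪ L' t))) := by
  induction U using Finset.induction_on_min with
  | empty =>
    have h1 : (⋂ t ∈ (∅ : Finset (Fin m)), (R t ∪ L t)) = (Set.univ : Set α) := by ext x; simp
    have h2 : (⋂ t ∈ (∅ : Finset (Fin m)), (R' t ∪ L' t)) = (Set.univ : Set β) := by ext y; simp
    have hu1 : ind (Set.univ : Set α) = 1 := by funext x; exact ind_of_mem (Set.mem_univ x)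
    have hu2 : ind (Set.univ : Set β) = 1 := by funext y; exact ind_of_mem (Set.mem_univ y)
    rw [h1, h2, hu1, hu2]
    refine ⟨by rw [ex_one hμ, ex_one hν], fun v _ => ?_⟩
    rw [mul_one, mul_one, ha v]
  | insert u U hmin ih =>
    have hu : ∀ t ∈ U, u ≤ t := fun t ht => le_of_lt (hmin t ht)
    obtain ⟨ih1, ih2⟩ := ih
    have hRL : ex μ (ind (R u) * ind (L u)) = ex ν (ind (R' u) * ind (L' u)) := by
      rw [hind u u le_rfl, hind' u u le_rfl, ha, hb]
    constructor
    · rw [ind_cap_insert_min' R L hL hu, ind_cap_insert_min' R' L' hL' hu, ex_add_sub, ex_add_sub,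
        ih2 u hu, hb u, hRL]
    · intro v hvU
      have hv : v ≤ u := hvU u (mem_insert_self u U)
      rw [ind_cap_insert_min R L hR hL hu hv, ind_cap_insert_min R' L' hR' hL' hu hv, ex_add_sub, ex_add_sub,
        ih2 u hu, hind v u hv, hind' v u hv, ha, hb, hRL]

/-! ### The theorem -/

/-- **Sahi positivity of every order for caps of two independent chains.**  Let `μ` be a probability weight on
the finite type `α`; `R v` an antitone and `L v` a monotone chain of events (`v : Fin m`) with
`E[1_{R v}1_{L v'}] = E[1_{R v}]E[1_{L v'}]` for `v ≤ v'`.  Then for every `n` and all target sets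
`T_0, …, T_{n-1} ⊆ Fin m`, `0 ≤ E_n(1_{⋂_{t∈T_0}(R t ∪ L t)}, …, 1_{⋂_{t∈T_{n-1}}(R t ∪ L t)})`. [this work] -/
theorem sahiE_nonneg_of_twoChainCaps (μ : α → ℝ) (hμ0 : ∀ x, 0 ≤ μ x) (hμ1 : ∑ x, μ x = 1)
    (R L : Fin m → Set α)
    (hR : ∀ ⦃v v' : Fin m⦄, v ≤ v' → R v' ⊆ R v) (hL : ∀ ⦃v v' : Fin m⦄, v ≤ v' → L v ⊆ L v')
    (hind : ∀ v v' : Fin m, v ≤ v' → ex μ (ind (R v) * ind (L v')) = ex μ (ind (R v)) * ex μ (ind (L v')))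
    (n : ℕ) (T : Fin n → Finset (Fin m)) :
    0 ≤ sahiE μ n (fun i => ind (⋂ t ∈ T i, (R t ∪ L t))) := by
  -- the two chain levels
  let ρ : α → Fin (m + 1) := fun x =>
    ⟨(univ.filter fun k : Fin m => x ∈ R k).card,
      Nat.lt_succ_of_le ((card_filter_le _ _).trans (by rw [Finset.card_fin]))⟩
  let lam : α → Fin (m + 1) := fun x =>
    ⟨(univ.filter fun k : Fin m => x ∈ L k).card,
      Nat.lt_succ_of_le ((card_filter_le _ _).trans (by rw [Finset.card_fin]))⟩
  have hρ : ∀ x (k : Fin m), x ∈ R k ↔ k.val < (ρ x).val := by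
    intro x k
    have h := TwoChainUnions.mem_iff_lt_card_of_lower (D := univ.filter fun k : Fin m => x ∈ R k)
      (fun k k' hkk' hk => by
        simp only [mem_filter, mem_univ, true_and] at hk ⊢
        exact hR hkk' hk) k
    simpa only [mem_filter, mem_univ, true_and] using h
  have hlam : ∀ x (k : Fin m), x ∈ L k ↔ m - (lam x).val ≤ k.val := by
    intro x k
    have h := TwoChainUnions.mem_iff_sub_card_le_of_upper (U := univ.filter fun k : Fin m => x ∈ L k)
      (fun k k' hkk' hk => by
        simp only [mem_filter, mem_univ, true_and] at hk ⊢
        exact hL hkk' hk) k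
    simpa only [mem_filter, mem_univ, true_and] using h
  -- the model: product of the two level laws, coordinate chains
  let w₁ : Fin (m + 1) → ℝ := pushWeight μ ρ
  let w₂ : Fin (m + 1) → ℝ := pushWeight μ lam
  let W : Fin (m + 1) × Fin (m + 1) → ℝ := fun p => w₁ p.1 * w₂ p.2
  let R' : Fin m → Set (Fin (m + 1) × Fin (m + 1)) := fun v => {p | v.val < p.1.val}
  let L' : Fin m → Set (Fin (m + 1) × Fin (m + 1)) := fun v => {p | m - p.2.val ≤ v.val}
  have hW1 : ∑ p, W p = 1 := by
    simp only [W]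
    rw [Fintype.sum_prod_type, ← Finset.sum_mul_sum]
    simp only [w₁, w₂, sum_pushWeight, hμ1, mul_one]
  have hR' : ∀ ⦃v v' : Fin m⦄, v ≤ v' → R' v' ⊆ R' v :=
    fun v v' h p hp => lt_of_le_of_lt (Fin.le_def.1 h) hp
  have hL' : ∀ ⦃v v' : Fin m⦄, v ≤ v' → L' v ⊆ L' v' :=
    fun v v' h p hp => le_trans hp (Fin.le_def.1 h)
  -- one-dimensional functions representing the model chains
  let F₁ : Fin m → Fin (m + 1) → ℝ := fun v r => if v.val < r.val then 1 else 0
  let F₂ : Fin m → Fin (m + 1) → ℝ := fun v l => if m - l.val ≤ v.val then 1 else 0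
  have hF₁ : ∀ v, ind (R' v) = fun p : Fin (m + 1) × Fin (m + 1) => F₁ v p.1 * (1 : Fin (m + 1) → ℝ) p.2 := by
    intro v; funext p
    simp only [F₁, Pi.one_apply, mul_one]
    by_cases h : v.val < p.1.val
    · rw [if_pos h]; exact ind_of_mem h
    · rw [if_neg h]; exact ind_of_not_mem h
  have hF₂ : ∀ v, ind (L' v) = fun p : Fin (m + 1) × Fin (m + 1) => (1 : Fin (m + 1) → ℝ) p.1 * F₂ v p.2 := by
    intro v; funext p
    simp only [F₂, Pi.one_apply, one_mul]
    by_cases h : m - p.2.val ≤ v.val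
    · rw [if_pos h]; exact ind_of_mem h
    · rw [if_neg h]; exact ind_of_not_mem h
  have hF₁₂ : ∀ v v', ind (R' v) * ind (L' v') =
      fun p : Fin (m + 1) × Fin (m + 1) => F₁ v p.1 * F₂ v' p.2 := by
    intro v v'; funext p
    rw [Pi.mul_apply, hF₁, hF₂]
    simp only [Pi.one_apply, mul_one, one_mul]
  have hw₁1 : ex w₁ (1 : Fin (m + 1) → ℝ) = 1 := ex_one (by simp only [w₁, sum_pushWeight, hμ1])
  have hw₂1 : ex w₂ (1 : Fin (m + 1) → ℝ) = 1 := ex_one (by simp only [w₂, sum_pushWeight, hμ1])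
  have hexR' : ∀ v, ex W (ind (R' v)) = ex w₁ (F₁ v) := by
    intro v; rw [hF₁, TwoChainUnions.ex_prodWeight_mul w₁ w₂ (F₁ v) 1, hw₂1, mul_one]
  have hexL' : ∀ v, ex W (ind (L' v)) = ex w₂ (F₂ v) := by
    intro v; rw [hF₂, TwoChainUnions.ex_prodWeight_mul w₁ w₂ 1 (F₂ v), hw₁1, one_mul]
  have hind' : ∀ v v' : Fin m, v ≤ v' →
      ex W (ind (R' v) * ind (L' v')) = ex W (ind (R' v)) * ex W (ind (L' v')) := by
    intro v v' _
    rw [hF₁₂, TwoChainUnions.ex_prodWeight_mul w₁ w₂ (F₁ v) (F₂ v'), hexR', hexL']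
  -- the one-chain probabilities agree with the model ones
  have ha : ∀ v, ex μ (ind (R v)) = ex W (ind (R' v)) := by
    intro v
    rw [hexR', show w₁ = pushWeight μ ρ from rfl, ex_pushWeight]
    congr 1
    funext x
    simp only [Function.comp_apply, F₁]
    by_cases hx : x ∈ R v
    · rw [ind_of_mem hx, if_pos ((hρ x v).1 hx)]
    · rw [ind_of_not_mem hx, if_neg (fun h => hx ((hρ x v).2 h))]
  have hb : ∀ v, ex μ (ind (L v)) = ex W (ind (L' v)) := by
    intro v
    rw [hexL', show w₂ = pushWeight μ lam from rfl, ex_pushWeight]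
    congr 1
    funext x
    simp only [Function.comp_apply, F₂]
    by_cases hx : x ∈ L v
    · rw [ind_of_mem hx, if_pos ((hlam x v).1 hx)]
    · rw [ind_of_not_mem hx, if_neg (fun h => hx ((hlam x v).2 h))]
  -- model positivity: caps of the coordinate chains are increasing events on a product of two chains
  have hup : ∀ U : Finset (Fin m), IsUpperSet (⋂ t ∈ U, (R' t ∪ L' t)) := by
    intro U
    refine isUpperSet_iInter₂ fun t _ => IsUpperSet.union ?_ ?_
    · intro p q hpq hp
      exact lt_of_lt_of_le hp (Fin.le_def.1 (Prod.mk_le_mk.1 hpq).1)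
    · intro p q hpq hp
      have := Fin.le_def.1 (Prod.mk_le_mk.1 hpq).2
      exact le_trans (Nat.sub_le_sub_left this m) hp
  have hmodel : 0 ≤ sahiE W n (fun i => ind (⋂ t ∈ T i, (R' t ∪ L' t))) :=
    ProductChains.sahiPositive_prodWeight_linearOrder w₁ w₂ (pushWeight_nonneg hμ0 _)
      (by rw [sum_pushWeight, hμ1]) (pushWeight_nonneg hμ0 _) (by rw [sum_pushWeight, hμ1]) n _
      (fun i p => ind_nonneg _ p) (fun i => monotone_ind_of_upper (hup (T i)))
  -- transfer along the product moments
  rw [TwoChainUnions.sahiE_congr_of_prodMoments μ W n (fun i => ind (⋂ t ∈ T i, (R t ∪ L t)))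
    (fun i => ind (⋂ t ∈ T i, (R' t ∪ L' t))) fun S => ?_]
  · exact hmodel
  rw [prod_ind_cap R L T S, prod_ind_cap R' L' T S]
  exact (ex_ind_cap_congr μ W hμ1 hW1 R L R' L' hR hL hR' hL' hind hind' ha hb (S.biUnion T)).1

end TwoChainCaps

end Summit.CriticalPhenomena.PercolationContinuityZ3.Theorems
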